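import Summits.QuantumFields.YangMills.Theorems.BalabanUVNodesN21HazardFromLogLipschitz

/-!
# N21 (NE7c) · (M1) for the block-sup of DEPENDENT Gibbs coordinates from a uniform one-sided partial-slope bound —
# constant `e·Λ·θ`, no independence, no Gaussian comparison, no dependence on the number of variables

R134 seat pub-ymgap-dag-n21-d (g8), node N21 = NE7c (single-run shell-weight bound, NOT PRINTED in [Bałaban 1983–89],
NOT proved), lane K3⁷ `SpineGivenEndpointR13SepCoPH` (stmt-QuantumFields-20544, `--kind proof --supports … --as helper`).
Part 9 of the comparison series; consumes part 7 (`…N21FirstExceedanceHazard`, the dependent hazard principle) and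
part 8 (`…N21HazardFromLogLipschitz`, the one-dimensional log-Lipschitz device).

WHAT THIS FILE IS.  Parts 7–8 left ONE modelling assumption between the comparison series and a Gibbs-type fibre law:
independence of the tested variables.  This file removes it.  Let `ν = e^{−A(x)} dx` on `ℝ^ι` (`ι` finite), `A` ANY
measurable coupling of the coordinates, and suppose the ONE-SIDED PARTIAL-SLOPE BOUND
`A(x with x_p := y₂) − A(x with x_p := y₁) ≤ Λ·(y₂ − y₁)` for `θ(1−ρ) ≤ y₁ < θ`, `y₁ ≤ y₂ ≤ y₁ + Λ⁻¹`, UNIFORMLY in the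
other coordinates `x`.  Then, coordinate by coordinate, the conditional law of `x_p` given the others has density
`∝ e^{−A(x with x_p := ·)}`, part 8 §3 bounds its shell mass by `e·Λ·θρ ×` its exceedance mass, and integrating over the
other coordinates ON ANY EVENT THEY DEFINE (Tonelli, `MeasureTheory.lmarginal_erase'`) gives part 7's conditional
windowed hazard bound at every sub-level event (§1 `measure_coordSlice_le_of_partialSlope`).  Part 7 §2 then yields
(§2) `ν{θ(1−ρ) ≤ ⨆ x < θ} ≤ e·Λ·θρ · ν{θ(1−ρ) ≤ ⨆ x}` and
`T4ShellMeasure.SlotAntiConcentration ν (x ↦ ⨆ p, x p) θ ρ (e·Λ·θ)` — for ARBITRARILY COUPLED coordinates.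

READING FOR THE WALL (hedged; nothing is claimed for Bałaban's measure).  The (2.18) fibre law is of this Gibbs type
(`e^{−A∕g²} ×` small-field characteristic functions, on a product of compact groups rather than lines, with the tested
plaquette variables nonlinear functions of the integration variables rather than coordinates).  In the present
caricature the ONLY analytic input for a level-uniform (M1) constant of the block-sup is an upper bound `Λ` on the
partial slope of the action along one tested direction across one shell width above the threshold, uniform in
everything else; `Λ·θ ≈ x²` at `x` standard deviations for a quadratic action (lens Card 51's polylog profile).  The
small-field characteristic functions of the OTHER variables are sub-level events and ride along (§1 allows any event of
the other coordinates); what the caricature does not model is listed in the HONEST FRAMING.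

HONEST FRAMING.  [textbook] measure theory (Tonelli on a finite product) over parts 7–8; 0 def, 0 sorry.  Not modelled:
the group-valued variables, the nonlinearity `u_p = |F_p(U_min(V))|` (device (b)'s transversal slope `κ` of
`T4ShellMeasure.slotAntiConcentration_of_transversal` would enter), characteristic functions involving the tested
variable itself at nearby thresholds, and the history structure of the true law.  NE7c NOT PRINTED ∕ NOT proved; N21 NOT
discharged; counts unmoved (typed 28∕28 · discharged 5∕27); count-neutral; one finite 𝕋⁴ at fixed ε — nothing about
ℝ⁴ ∕ OS ∕ mass gap ∕ Clay.
-/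

open MeasureTheory Set Function
open scoped ENNReal NNReal

namespace Summit.QuantumFields.YangMills.Theorems.N21GibbsBlockSupHazard

open Literature.MathematicalPhysics.QuantumFieldTheory.Balaban1983to89.T4ShellMeasure (SlotAntiConcentration)
open Summit.QuantumFields.YangMills.Theorems.N21FirstExceedanceHazard (measure_shell_iSup_le_of_condHazard)
open Summit.QuantumFields.YangMills.Theorems.N21HazardFromLogLipschitz (withDensity_exp_neg_Ico_le_of_logLipschitz)

variable {ι : Type*} [Fintype ι] [DecidableEq ι]

/-! ## §1 Tonelli: a fibrewise windowed hazard bound integrates to the conditional bound at every event of the others -/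

/-- **FIBREWISE ⇒ CONDITIONAL.**  Let `ν = (pi volume).withDensity g` on `ℝ^ι`, fix a coordinate `p` and two
measurable sets `S₁, T₁ ⊆ ℝ` (below: the shell `[a, b)` and the exceedance set `[a, ∞)` of the coordinate, or their
preimages under a transversal reading).  If along EVERY `p`-fibre the one-dimensional density `y ↦ g(x with x_p := y)`
satisfies `∫_{S₁} ≤ c · ∫_{T₁}`, then for every set `C` of configurations NOT READING `x_p`
(`x ∈ C ↔ (x with x_p := y) ∈ C`), `ν({x_p ∈ S₁} ∩ C) ≤ c · ν({x_p ∈ T₁} ∩ C)` (Tonelli: `lmarginal_erase'`). [textbook] -/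
theorem measure_coordSlice_le_of_fibrewise {g : (ι → ℝ) → ℝ≥0∞} (hg : Measurable g) (p : ι) {S₁ T₁ : Set ℝ}
    (hS₁ : MeasurableSet S₁) (hT₁ : MeasurableSet T₁) (c : ℝ≥0∞) (hc : c ≠ ⊤)
    (hfib : ∀ x : ι → ℝ, ∫⁻ y in S₁, g (update x p y) ≤ c * ∫⁻ y in T₁, g (update x p y))
    {C : Set (ι → ℝ)} (hC : MeasurableSet C) (hCp : ∀ x y, update x p y ∈ C ↔ x ∈ C) :
    (Measure.pi fun _ : ι => (volume : Measure ℝ)).withDensity g ({x | x p ∈ S₁} ∩ C)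
      ≤ c * (Measure.pi fun _ : ι => (volume : Measure ℝ)).withDensity g ({x | x p ∈ T₁} ∩ C) := by
  have hSm : MeasurableSet ({x : ι → ℝ | x p ∈ S₁} ∩ C) := (measurable_pi_apply p hS₁).inter hC
  have hFm : MeasurableSet ({x : ι → ℝ | x p ∈ T₁} ∩ C) := (measurable_pi_apply p hT₁).inter hC
  set S : Set (ι → ℝ) := {x | x p ∈ S₁} ∩ C with hS
  set F : Set (ι → ℝ) := {x | x p ∈ T₁} ∩ C with hF
  have hSi : Measurable (S.indicator g) := hg.indicator hSm
  have hFi : Measurable (fun x => c * F.indicator g x) := (hg.indicator hFm).const_mul c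
  rw [withDensity_apply _ hSm, withDensity_apply _ hFm, ← lintegral_indicator hSm, ← lintegral_indicator hFm,
    ← lintegral_const_mul c (hg.indicator hFm)]
  classical
  obtain ⟨x₀⟩ : Nonempty (ι → ℝ) := ⟨fun _ => 0⟩
  rw [lintegral_eq_lmarginal_univ x₀, lintegral_eq_lmarginal_univ x₀,
    lmarginal_erase' (S.indicator g) hSi (Finset.mem_univ p),
    lmarginal_erase' (fun x => c * F.indicator g x) hFi (Finset.mem_univ p)]
  refine lmarginal_mono (fun x => ?_) x₀
  -- the `p`-fibre through `x`: indicators of `S` ∕ `F` become `1_C(x) ·` window indicators in `y`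
  by_cases hx : x ∈ C
  · have hS' : ∀ y, S.indicator g (update x p y) = S₁.indicator (fun y => g (update x p y)) y := by
      intro y
      by_cases hy : y ∈ S₁
      · rw [indicator_of_mem _ _, indicator_of_mem hy]
        exact ⟨by simpa using hy, (hCp x y).2 hx⟩
      · rw [indicator_of_notMem _ _, indicator_of_notMem hy]
        rintro ⟨hy', -⟩
        exact hy (by simpa using hy')
    have hF' : ∀ y, c * F.indicator g (update x p y) = c * T₁.indicator (fun y => g (update x p y)) y := by
      intro y
      by_cases hy : y ∈ T₁
      · rw [indicator_of_mem _ _, indicator_of_mem hy]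
        exact ⟨by simpa using hy, (hCp x y).2 hx⟩
      · rw [indicator_of_notMem _ _, indicator_of_notMem hy]
        rintro ⟨hy', -⟩
        exact hy (by simpa using hy')
    simp only [hS', hF']
    rw [lintegral_indicator hS₁, lintegral_const_mul' _ _ hc, lintegral_indicator hT₁]
    exact hfib x
  · have hS' : ∀ y, S.indicator g (update x p y) = 0 := fun y =>
      indicator_of_notMem (fun h => hx ((hCp x y).1 h.2)) _
    simp only [hS', lintegral_zero]
    exact bot_le

/-- **THE CONDITIONAL HAZARD BOUND FOR GIBBS COORDINATES.**  For `ν = e^{−A(x)} dx` on `ℝ^ι` with `A` measurable and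
the one-sided partial-slope bound `A(x_p := y₂) − A(x_p := y₁) ≤ Λ(y₂ − y₁)` (`a ≤ y₁ < b`, `y₁ ≤ y₂ ≤ y₁ + Λ⁻¹`,
uniformly in the other coordinates), every sub-level event `C = {x q < t q, q ≠ p}` of the other coordinates satisfies
`ν({a ≤ x_p < b} ∩ C) ≤ e·Λ·(b − a) · ν({a ≤ x_p} ∩ C)` — part 7's hypothesis, for arbitrarily coupled coordinates
(part 8 §3 on each fibre + §1). [textbook] -/
theorem measure_coordSlice_le_of_partialSlope {A : (ι → ℝ) → ℝ} (hA : Measurable A) (p : ι) {a b Λ : ℝ}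
    (hΛ : 0 < Λ)
    (hslope : ∀ x : ι → ℝ, ∀ y₁ ∈ Ico a b, ∀ y₂ ∈ Icc y₁ (y₁ + Λ⁻¹),
      A (update x p y₂) - A (update x p y₁) ≤ Λ * (y₂ - y₁))
    (t : ι → ℝ) :
    (Measure.pi fun _ : ι => (volume : Measure ℝ)).withDensity (fun x => ENNReal.ofReal (Real.exp (-A x)))
        ({x | a ≤ x p ∧ x p < b} ∩ {x | ∀ q, q ≠ p → x q < t q})
      ≤ ENNReal.ofReal (Real.exp 1 * Λ * (b - a)) *
        (Measure.pi fun _ : ι => (volume : Measure ℝ)).withDensity (fun x => ENNReal.ofReal (Real.exp (-A x)))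
          ({x | a ≤ x p} ∩ {x | ∀ q, q ≠ p → x q < t q}) := by
  have hg : Measurable fun x : ι → ℝ => ENNReal.ofReal (Real.exp (-A x)) :=
    ENNReal.measurable_ofReal.comp (Real.measurable_exp.comp hA.neg)
  have hC : MeasurableSet {x : ι → ℝ | ∀ q, q ≠ p → x q < t q} := by
    have : {x : ι → ℝ | ∀ q, q ≠ p → x q < t q} = ⋂ q, {x | q ≠ p → x q < t q} := by
      ext x; simp only [mem_setOf_eq, mem_iInter]
    rw [this]
    refine MeasurableSet.iInter fun q => ?_
    by_cases hq : q = p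
    · have : {x : ι → ℝ | q ≠ p → x q < t q} = univ := by
        ext x; simp [hq]
      rw [this]; exact MeasurableSet.univ
    · have : {x : ι → ℝ | q ≠ p → x q < t q} = {x | x q < t q} := by
        ext x; simp [hq]
      rw [this]; exact measurableSet_lt (measurable_pi_apply q) measurable_const
  have hCp : ∀ (x : ι → ℝ) (y : ℝ),
      update x p y ∈ {x : ι → ℝ | ∀ q, q ≠ p → x q < t q} ↔ x ∈ {x : ι → ℝ | ∀ q, q ≠ p → x q < t q} := by
    intro x y
    simp only [mem_setOf_eq]
    refine forall_congr' fun q => forall_congr' fun hq => ?_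
    rw [update_of_ne hq]
  -- the `p`-fibre through `x` is the law with density `e^{−W}`, `W = A(x with x_p := ·)`
  have hfib : ∀ x : ι → ℝ, ∫⁻ y in Ico a b, ENNReal.ofReal (Real.exp (-A (update x p y)))
      ≤ ENNReal.ofReal (Real.exp 1 * Λ * (b - a)) * ∫⁻ y in Ici a, ENNReal.ofReal (Real.exp (-A (update x p y))) := by
    intro x
    have hW : Measurable fun y => A (update x p y) := hA.comp (measurable_update x)
    have h := withDensity_exp_neg_Ico_le_of_logLipschitz hW hΛ (fun y₁ hy₁ y₂ hy₂ => hslope x y₁ hy₁ y₂ hy₂)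
    rwa [withDensity_apply _ measurableSet_Ico, withDensity_apply _ measurableSet_Ici] at h
  exact measure_coordSlice_le_of_fibrewise hg p measurableSet_Ico measurableSet_Ici _ ENNReal.ofReal_ne_top hfib hC hCp

/-! ## §2 (M1) for the block-sup of dependent Gibbs coordinates -/

variable [Nonempty ι]

/-- **RELATIVE FORM**: `ν{a ≤ ⨆ x < b} ≤ e·Λ·(b − a) · ν{a ≤ ⨆ x}` for `ν = e^{−A} dx` under the uniform one-sided
partial-slope bound on `[a, b + Λ⁻¹]` — arbitrarily coupled coordinates, any number of them (part 7 §2 + §1). [textbook] -/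
theorem measure_shell_iSup_gibbs_le {A : (ι → ℝ) → ℝ} (hA : Measurable A) {a b Λ : ℝ} (hΛ : 0 < Λ)
    (hslope : ∀ p, ∀ x : ι → ℝ, ∀ y₁ ∈ Ico a b, ∀ y₂ ∈ Icc y₁ (y₁ + Λ⁻¹),
      A (update x p y₂) - A (update x p y₁) ≤ Λ * (y₂ - y₁)) :
    (Measure.pi fun _ : ι => (volume : Measure ℝ)).withDensity (fun x => ENNReal.ofReal (Real.exp (-A x)))
        {x | a ≤ (⨆ p, x p) ∧ (⨆ p, x p) < b}
      ≤ ENNReal.ofReal (Real.exp 1 * Λ * (b - a)) *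
        (Measure.pi fun _ : ι => (volume : Measure ℝ)).withDensity (fun x => ENNReal.ofReal (Real.exp (-A x)))
          {x | a ≤ ⨆ p, x p} :=
  measure_shell_iSup_le_of_condHazard _ (fun p (x : ι → ℝ) => x p) a b (fun p => measurable_pi_apply p) _
    fun p s _ => measure_coordSlice_le_of_partialSlope hA p hΛ (hslope p) fun q => if q ∈ s then a else b

/-- **(M1) FOR THE BLOCK-SUP OF DEPENDENT GIBBS COORDINATES, constant `e·Λ·θ`.**  For `ν = e^{−A(x)} dx` on `ℝ^ι`,
`A` ANY measurable coupling with the one-sided partial-slope bound `≤ Λ` (`Λ > 0`) along each coordinate on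
`[θ(1−ρ), θ + Λ⁻¹]`, uniformly in the other coordinates:
`T4ShellMeasure.SlotAntiConcentration ν (x ↦ ⨆ p, x p) θ ρ (e·Λ·θ)` — no independence, no Gaussian comparison, no
dependence on the number of coordinates. [textbook] -/
theorem slotAntiConcentration_iSup_gibbs {A : (ι → ℝ) → ℝ} (hA : Measurable A) {θ ρ Λ : ℝ} (hΛ : 0 < Λ)
    (hslope : ∀ p, ∀ x : ι → ℝ, ∀ y₁ ∈ Ico (θ * (1 - ρ)) θ, ∀ y₂ ∈ Icc y₁ (y₁ + Λ⁻¹),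
      A (update x p y₂) - A (update x p y₁) ≤ Λ * (y₂ - y₁)) :
    SlotAntiConcentration
      ((Measure.pi fun _ : ι => (volume : Measure ℝ)).withDensity fun x => ENNReal.ofReal (Real.exp (-A x)))
      (fun x => ⨆ p, x p) θ ρ (Real.exp 1 * Λ * θ) := by
  unfold SlotAntiConcentration
  have h := measure_shell_iSup_gibbs_le hA hΛ hslope
  rw [show Real.exp 1 * Λ * (θ - θ * (1 - ρ)) = Real.exp 1 * Λ * θ * ρ by ring] at h
  exact h.trans (mul_le_mul_right (measure_mono (subset_univ _)) _)

end Summit.QuantumFields.YangMills.Theorems.N21GibbsBlockSupHazard
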